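import Summits.QuantumFields.YangMills.Theorems.BalabanUVNodesN06Thm312313ParLawsQStar
import Literature.MathematicalPhysics.QuantumFieldTheory.Balaban1983to89.B9Eq3132Ineq2142Covariant

/-!
# BalabanUVNodes ∕ N06 ([B9], `Dag.B9_main`) — ROW 26 AT THE KNIT PAIR, PIECE 1: [4]-(2.142) AT THE CONFIGURATION `U` FOR `𝔮(U) T(U) 𝔮⋆(U)` WITH A ROW-MAJORISED
# LETTER `𝔮` AND A COLUMN-MAJORISED `𝔮⋆` (kernel-generic), AND ITS INSTANCE AT PRINT's KNIT AVERAGING `Q(U) = QknitY`, `Q⋆(U) = adjTrY (QknitY U)` ON (3.35)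

Track A of `YM-PLAN.md` (cell `pub-ymgap`, HUMAN RULING D-0062), node **N06** = [Balaban1985BackgroundPropagators] Thms 3.1–3.15; the knit certificate «KA» (✓p779333)
displays ROW 26 = (3.132) as `s3132K` because its supplier of record (`B9Eq3132FromStateR.s3132Nu_opsYSectE_of_stepS_R_of_refinesY` ← `B9Eq3132DecayFromMajorant` ←
`B9Eq3132Ineq2142Covariant.norm_QGQOfY_deltaY_le`) is keyed to the STRAIGHT pair `QGQOfY i parBY T U = Q_U T Q*_U` (flat weights `q_y(f)`, taxi transporters).  THIS FILE is the
first piece of the knit road («P-Q26-knit», seat `pub-ymgap-dag-n06-l` g37, 2026-08-30): dag-n06-i's (2.142)-at-`U` re-pressed for def-Y's `QGQOfQY i 𝔮 𝔮⋆ T U = 𝔮(U) ∘ T(U) ∘ 𝔮⋆(U)`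
(`Node00.OpsYSectDQ`) with the pair entering ONLY through a ROW bound `‖(𝔮(U)a)(y)‖ ≤ Σ_f k y f‖a f‖` and a COLUMN bound `‖(𝔮⋆(U)Ψ)(f)‖ ≤ C⋆·Σ_ι k ι f‖Ψ ι‖` for one kernel
`k ≥ 0` (support within `ℓ + 4` of `bI`, levels not raised, entries `≤ K₁·n⁻¹`, rows of mass `≤ K`), then instantiated at the knit pair on the member's local class (3.35) from the
rows-20∕21 law files ✓p780031 (`norm_QknitY_apply_le_sum_knitRow`) and ✓p781864 (`norm_adjTrY_apply_le_of_rowKernel`).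

HONEST FRAMING.  Finite-dimensional bookkeeping over landed objects; the block majorant of `T(U)` is a HYPOTHESIS (supplied downstream from row 20's state, as at the straight pair);
nothing of [B9] ∕ [4] asserted; COUNT-NEUTRAL; N06 NOT discharged; K1⁹ NOT closed; nothing continuum ∕ OS ∕ mass gap ∕ Clay.  0 `def`, 0 `sorry`.

THE PRINT.  [B9] p. 422 (3.132) «The operators (QG̃Q*)⁻¹, or (QG₁Q*)⁻¹, can be analyzed in the same way as the operator (Q′G′²Q′*)⁻¹»; [4] p. 248 (2.142)
«|(QGQ*)(b, b′)| ≤ O(1)(Lʲη)²(L^{j′}η)^{−d}e^{−δ₃d(b,b′)}»; [B9] (3.12)–(3.13) p. 393 (Q(U), Q*(U)), (3.115) p. 418 (print's Q over B8's contours); [5] (139)–(147) pp. 39–40.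

WHAT IS PROVED.  §1 `lvl_bI_le_of_boxK_ne_zero`, `len_bI_le_of_boxK_ne_zero`, `len_bI_le_of_knitRow_ne_zero` (the knit kernel does not raise levels under a level-faithful `bI`);
§2 ★★ `norm_QGQOfQY_deltaY_le` — (2.142) at `U`, kernel-generic: `‖(𝔮(U)T(U)𝔮⋆(U))(δ_{y′} ⊗ E)(y)‖ ≤ mN·(K·C⋆·K₁·C)·e^{2δ(ℓ+4)}·(Lʲη)(y)²·n_{y′}⁻¹·e^{−δd(y,y′)}·‖E‖`;
§3 ★★ `norm_QGQOfQY_deltaY_le_knit` — the same at `𝔮(U) = QknitY i U`, `𝔮⋆(U) = adjTrY (QknitY i U)` for `U` in `(bg9KP …).Reg335 c₀ α₀` (`G ≤ U(N)`, `c₀ ≤ 10`, `0 ≤ Mα₀`,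
`0 < α₀′ ≤ α_Q`, `K_pl(Mα₀)L⁴ < α₀′`): constant `(1 + 2(d+1)K_col α₀′)·N⁴·(1 + K_col α₀′)·C`.
[cite: Balaban1984PropagatorsII, (2.142) p.248, (2.51)–(2.52) p.232, (2.45)–(2.46) p.231; Balaban1985BackgroundPropagators, (3.132) p.422, (3.12)–(3.13) p.393, (3.115) p.418, (3.35) p.396;
Balaban1985Averaging, (139)–(147) pp.39–40; Balaban1984PropagatorsI, (1.18) p.20]
-/

noncomputable section

namespace Summit.QuantumFields.YangMills.BalabanUVNodes.N06Eq3132Ineq2142KnitQ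

open Literature.MathematicalPhysics.QuantumFieldTheory.Balaban1983to89
open Literature.MathematicalPhysics.QuantumFieldTheory.Balaban1983to89.Node00
open Literature.MathematicalPhysics.QuantumFieldTheory.Balaban1983to89.B6RandomWalk (HasMajorant)
open Literature.MathematicalPhysics.QuantumFieldTheory.Balaban1983to89.B6RandomWalkHom (HasMajorantHom hasMajorantHom_iff)
open Literature.MathematicalPhysics.QuantumFieldTheory.Balaban1983to89.B9CoReadingCoords (coordOpK XBK blkBK GcoK)
open Literature.MathematicalPhysics.QuantumFieldTheory.Balaban1983to89.B9Thm39ReadingCoords (cR39 cR39_nonneg)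
open Literature.MathematicalPhysics.QuantumFieldTheory.Balaban1983to89.B9CoordSliceMajorant (mul_norm_apply_le_of_hasMajorantHom)
open Literature.MathematicalPhysics.QuantumFieldTheory.Balaban1983to89.B6Ineq2142KLevelV1 (lvl β qwt qwt_le qwt_nonneg lev_ends_bounds)
open Literature.MathematicalPhysics.QuantumFieldTheory.Balaban1983to89.B6KLevelCensusIndexV1 (KIdx kGeo)
open Literature.MathematicalPhysics.QuantumFieldTheory.Balaban1983to89.B6GlobalChartV1 (blkV1)
open Literature.MathematicalPhysics.QuantumFieldTheory.Balaban1983to89.B9Thm34Ext (toB6)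
open Literature.MathematicalPhysics.QuantumFieldTheory.Balaban1983to89.B9GeoNormsKLevelV1 (geo9K)
open Literature.MathematicalPhysics.QuantumFieldTheory.Balaban1983to89.B9GeoLemma21KLevelV1 (one_le_k geo9K_len_pos geo9K_dist_triangle geo9K_dist_comm)
open Literature.MathematicalPhysics.QuantumFieldTheory.Balaban1983to89.B9RWSumsReadsNbr (nbr mem_nbr)
open Literature.MathematicalPhysics.QuantumFieldTheory.Balaban1983to89.B9Eq3132Ineq2142Covariant (two_le_RMh len_bI_le_of_qwt_ne_zero)
open Literature.MathematicalPhysics.QuantumFieldTheory.Balaban1983to89.Node00.OpsYQLetter (QLetterY QsLetterY adjTrY)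
open Literature.MathematicalPhysics.QuantumFieldTheory.Balaban1983to89.B9Eq316AveragingTransposeZd (alphaQ)
open Literature.MathematicalPhysics.QuantumFieldTheory.Balaban1983to89.B9Eq3115KnitLetterY (QknitY)
open Literature.MathematicalPhysics.QuantumFieldTheory.Balaban1983to89.B9Eq3115KnitLetterYOnto (kCol kCol_nonneg)
open Literature.MathematicalPhysics.QuantumFieldTheory.Balaban1983to89.B9Eq3115KnitLetterYRowCloseness (boxK boxK_nonneg iterBlockOf_of_boxK_ne_zero)
open Literature.MathematicalPhysics.QuantumFieldTheory.Balaban1983to89.B9C2FormBoxRegimeY (Kpl)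
open Literature.MathematicalPhysics.QuantumFieldTheory.Balaban1983to89.B9BackgroundsKLevelV1P (bg9KP)
open Literature.MathematicalPhysics.QuantumFieldTheory.Balaban1983to89.B7Prop2Explicit (unitaryUnits)
open Summit.QuantumFields.YangMills.BalabanUVNodes.N06Thm312313ParLawsQRow (dist_le_of_knitRow_ne_zero_bI sum_knitRow_le norm_QknitY_apply_le_sum_knitRow)
open Summit.QuantumFields.YangMills.BalabanUVNodes.N06Thm312313ParLawsQStar (norm_adjTrY_apply_le_of_rowKernel knitRow_le_plateau)

variable {𝔸 : Type} [NormedRing 𝔸] [NormedAlgebra ℂ 𝔸]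
variable {d ℓ : ℕ} {hd : 1 ≤ d + 1} {hL : Odd (ℓ + 1) ∧ 1 < ℓ + 1} {b₀ b₁ : ℝ}

/-! ## §1 The knit kernel does not raise levels under a level-faithful block map -/

section Levels

variable (i : KIdx d ℓ hd hL b₀ b₁) {bI : FBondY i → IBondY i}

/-- `boxK ι f ≠ 0 ⇒ j(bI f) ≤ j(ι)` for a level-faithful `bI` (the fine bond starts in an end block of `ι`: `iterBlockOf_of_boxK_ne_zero` + [6]'s `lev_ends_bounds`).
[cite: Balaban1984PropagatorsII, (2.2)–(2.4) p.224, (2.45) p.231; Balaban1985Averaging, p.24 (locality)] -/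
theorem lvl_bI_le_of_boxK_ne_zero (hlev : ∀ f : FBondY i, lvl i.hN i.D i.hk (bI f) = (blkV1 i.hN i.D f).1.1)
    {ι : IBondY i} {f : FBondY i} (hf : boxK i ι f ≠ 0) : lvl i.hN i.D i.hk (bI f) ≤ lvl i.hN i.D i.hk ι := by
  rw [hlev f]
  exact (lev_ends_bounds i.hN i.D i.hk (one_le_k i) (two_le_RMh i) ι (iterBlockOf_of_boxK_ne_zero i hf)).2

/-- hence `(Lʲη)(bI f) ≤ (Lʲη)(ι)` when `boxK ι f ≠ 0`. [cite: Balaban1985BackgroundPropagators, (3.41) p.397, bookkeeping] -/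
theorem len_bI_le_of_boxK_ne_zero (hlev : ∀ f : FBondY i, lvl i.hN i.D i.hk (bI f) = (blkV1 i.hN i.D f).1.1)
    {ι : IBondY i} {f : FBondY i} (hf : boxK i ι f ≠ 0) : (geo9K i).len (bI f) ≤ (geo9K i).len ι := by
  rw [B9GeoNormsKLevelV1.geo9K_len_kGeo, B9GeoNormsKLevelV1.geo9K_len_kGeo, B6KLevelCensusIndexV1.len_eq, B6KLevelCensusIndexV1.len_eq]
  refine div_le_div_of_nonneg_right ?_ (abs_nonneg _)
  exact pow_le_pow_right₀ (by exact_mod_cast Nat.succ_le_succ (Nat.zero_le ℓ)) (lvl_bI_le_of_boxK_ne_zero i hlev hf)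

/-- the knit row kernel `q_ι(f) + K_col α₀′ boxK ι f` does not raise levels: `(Lʲη)(bI f) ≤ (Lʲη)(ι)` on its support. [cite: Balaban1984PropagatorsII, (2.45) p.231, bookkeeping] -/
theorem len_bI_le_of_knitRow_ne_zero (hlev : ∀ f : FBondY i, lvl i.hN i.D i.hk (bI f) = (blkV1 i.hN i.D f).1.1)
    {α₀' : ℝ} {ι : IBondY i} {f : FBondY i} (hf : qwt i.hN i.D i.hk ι f + kCol (d + 1) (ℓ + 1) * α₀' * boxK i ι f ≠ 0) :
    (geo9K i).len (bI f) ≤ (geo9K i).len ι := by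
  by_cases hq : qwt i.hN i.D i.hk ι f = 0
  · have hb : boxK i ι f ≠ 0 := by
      intro hb; apply hf; rw [hq, hb, mul_zero, add_zero]
    exact len_bI_le_of_boxK_ne_zero i hlev hb
  · exact len_bI_le_of_qwt_ne_zero i hlev hq

end Levels

/-! ## §2 ★★ (2.142) at `U`, kernel-generic: `𝔮(U) T(U) 𝔮⋆(U)` from one block majorant of `T(U)`, a row bound for `𝔮` and a column bound for `𝔮⋆` -/

section Ineq2142

variable {κ : Type} [Fintype κ] [DecidableEq κ]
variable [CompleteSpace 𝔸] [FiniteDimensional ℝ 𝔸]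

open Classical in
/-- ★★ **(2.142) AT `U` FOR `𝔮(U) T(U) 𝔮⋆(U)`, KERNEL-GENERIC** (dag-n06-i's `norm_QGQOfY_deltaY_le` with the straight pair's flat weights and taxi transports replaced by ONE kernel `k ≥ 0`):
`bI` 1-faithful, radius-`(ℓ+4)` count `mN`; `k y f ≠ 0 ⇒ d(bI f, y) ≤ ℓ + 4 ∧ (Lʲη)(bI f) ≤ (Lʲη)(y)`, `k y f ≤ K₁·n_y⁻¹` (`K₁ ≥ 0`), `Σ_f k y f ≤ K`; ROW bound `‖(𝔮(U)a)(y)‖ ≤ Σ_f k y f‖a f‖`,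
COLUMN bound `‖(𝔮⋆(U)Ψ)(f)‖ ≤ C⋆Σ_ι k ι f‖Ψ ι‖`; the [4]-(2.51) majorant `C(Lʲη)²e^{−δd}` of `GcoK … T U₁`.  THEN
`‖(𝔮(U)T(U)𝔮⋆(U))(δ_{y′} ⊗ E)(y)‖ ≤ mN·(K·C⋆·K₁·C)·e^{2δ(ℓ+4)}·(Lʲη)(y)²·n_{y′}⁻¹·e^{−δd(y,y′)}·‖E‖`, `n_{y′} = L^{(d+1)j(y′)}`.
[cite: Balaban1984PropagatorsII, (2.142) p.248, (2.51)–(2.52) p.232; Balaban1985BackgroundPropagators, (3.132) p.422, (3.12)–(3.13) p.393] -/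
theorem norm_QGQOfQY_deltaY_le (i : KIdx d ℓ hd hL b₀ b₁) [instF : Fintype (geo9K i).Site] (b : Module.Basis κ ℝ 𝔸)
    {B : B9.Backgrounds} (cfg : B.Cfg → CfgY 𝔸 i) (T : BondOpY 𝔸 i) (𝔮 : QLetterY 𝔸 i) (𝔮s : QsLetterY 𝔸 i) (U₁ : B.Cfg)
    {bI : FBondY i → IBondY i}
    (hβ1 : ∀ f : FBondY i, (B6Geom246MultiLevelTorus.geomT i.D).dist (β i.hN i.D i.hk (bI f)) (blkV1 i.hN i.D f) ≤ 1)
    {mN : ℕ} (hnbr : ∀ y : (geo9K i).Site, (nbr (geo9K i) ((ℓ : ℝ) + 4) y).card ≤ mN)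
    (k : IBondY i → FBondY i → ℝ) (hk0 : ∀ y f, 0 ≤ k y f)
    (hkdist : ∀ y f, k y f ≠ 0 → (geo9K i).dist (bI f) y ≤ (ℓ : ℝ) + 4)
    (hklen : ∀ y f, k y f ≠ 0 → (geo9K i).len (bI f) ≤ (geo9K i).len y)
    {K₁ : ℝ} (hK₁ : 0 ≤ K₁) (hkle : ∀ y f, k y f ≤ K₁ * ((((ℓ + 1 : ℕ) : ℝ) ^ (d + 1)) ^ (lvl i.hN i.D i.hk y))⁻¹)
    {K : ℝ} (hkmass : ∀ y, ∑ f, k y f ≤ K)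
    (hrow : ∀ (a : FBondY i → 𝔸) (y : IBondY i), ‖𝔮 (cfg U₁) a y‖ ≤ ∑ f, k y f * ‖a f‖)
    {Cs : ℝ} (hCs : 0 ≤ Cs) (hcol : ∀ (Ψ : IBondY i → 𝔸) (f : FBondY i), ‖𝔮s (cfg U₁) Ψ f‖ ≤ Cs * ∑ ι, k ι f * ‖Ψ ι‖)
    {R : ℝ} {H : Prop} {C δ : ℝ} (hC : 0 ≤ C) (hδ : 0 ≤ δ)
    (h0 : HasMajorant (g := toB6 (geo9K i) R H) (blkBK i bI) (GcoK i b B cfg T U₁)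
      (fun a a' => C * (geo9K i).len a ^ 2 * Real.exp (-(δ * (geo9K i).dist a a'))))
    (y y' : IBondY i) (E : 𝔸) :
    ‖QGQOfQY i 𝔮 𝔮s T (cfg U₁) (deltaY y' E) y‖ ≤
      mN * (K * Cs * K₁ * C) * Real.exp (2 * (δ * ((ℓ : ℝ) + 4))) * (geo9K i).len y ^ 2 * ((((ℓ + 1 : ℕ) : ℝ) ^ (d + 1)) ^ (lvl i.hN i.D i.hk y'))⁻¹ *
        Real.exp (-(δ * (geo9K i).dist y y')) * ‖E‖ := by
  have _ := hβ1
  -- the test function `λ = 𝔮⋆(U)(δ_{y′} ⊗ E)`: support and size from the column bound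
  set lam : FBondY i → 𝔸 := 𝔮s (cfg U₁) (deltaY y' E) with hlam
  set cl : ℝ := Cs * K₁ * ((((ℓ + 1 : ℕ) : ℝ) ^ (d + 1)) ^ (lvl i.hN i.D i.hk y'))⁻¹ * ‖E‖ with hcl
  have hcl0 : 0 ≤ cl := by rw [hcl]; positivity
  have hcolδ : ∀ f : FBondY i, ‖lam f‖ ≤ Cs * (k y' f * ‖E‖) := by
    intro f
    refine (hcol _ f).trans (le_of_eq ?_)
    congr 1
    rw [Finset.sum_eq_single y']
    · simp [deltaY]
    · intro ι _ hι
      simp [deltaY, hι]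
    · intro h; exact absurd (Finset.mem_univ _) h
  have hsupp : ∀ f : FBondY i, ¬ (k y' f ≠ 0) → lam f = 0 := by
    intro f hf
    have h := hcolδ f
    rw [not_not.1 hf, zero_mul, mul_zero] at h
    exact norm_le_zero_iff.1 h
  have hbd : ∀ f : FBondY i, ‖lam f‖ ≤ cl := by
    intro f
    refine (hcolδ f).trans ?_
    rw [hcl, mul_assoc Cs K₁, mul_assoc Cs]
    exact mul_le_mul_of_nonneg_left (mul_le_mul_of_nonneg_right (hkle y' f) (norm_nonneg _)) hCs
  have hlen0 : ∀ a : (geo9K i).Site, 0 ≤ (geo9K i).len a := fun a => (geo9K_len_pos i a).le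
  -- the blocks met by the support of `λ`
  set I : Finset (IBondY i) := (Finset.univ.filter fun f : FBondY i => k y' f ≠ 0).image bI with hIdef
  have hI : ∀ f : FBondY i, k y' f ≠ 0 → bI f ∈ I := fun f hf =>
    Finset.mem_image_of_mem _ (Finset.mem_filter.2 ⟨Finset.mem_univ _, hf⟩)
  have hIcard : (I.card : ℝ) ≤ mN := by
    have h : I.card ≤ mN := by
      refine le_trans (Finset.card_le_card ?_) (hnbr y')
      intro c hc
      rw [hIdef, Finset.mem_image] at hc
      obtain ⟨f, hf, rfl⟩ := hc
      exact mem_nbr.2 (hkdist _ _ (Finset.mem_filter.1 hf).2)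
    exact_mod_cast h
  have hKer : ∀ a a' : (geo9K i).Site, 0 ≤ C * (geo9K i).len a ^ 2 * Real.exp (-(δ * (geo9K i).dist a a')) :=
    fun a a' => mul_nonneg (mul_nonneg hC (pow_nonneg (hlen0 a) 2)) (Real.exp_nonneg _)
  have h0' : HasMajorantHom (g := toB6 (geo9K i) R H) (fun p : XBK κ i => bI p.1) (fun p : XBK κ i => bI p.1)
      ((1 * cR39 b) • coordOpK b (fun _ : Fin (d + 1) => (T (cfg U₁)).restrictScalars ℝ))
      (fun a a' => C * (geo9K i).len a ^ 2 * Real.exp (-(δ * (geo9K i).dist a a'))) := by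
    rw [one_mul]; exact (hasMajorantHom_iff (g := toB6 (geo9K i) R H) _ _ _).2 h0
  -- the key constant
  set S : ℝ := cl * (mN * (C * (geo9K i).len y ^ 2 * Real.exp (2 * (δ * ((ℓ : ℝ) + 4))) * Real.exp (-(δ * (geo9K i).dist y y'))))
    with hSdef
  have hmain : ∀ f : FBondY i, k y f ≠ 0 → ‖T (cfg U₁) lam f‖ ≤ S := by
    intro f hf
    have step := mul_norm_apply_le_of_hasMajorantHom (g := toB6 (geo9K i) R H) b bI zero_le_one hKer h0'
      (fun f' : FBondY i => k y' f' ≠ 0) hsupp hcl0 hbd I hI f (0 : Fin (d + 1))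
    rw [one_mul, LinearMap.restrictScalars_apply] at step
    refine step.trans ?_
    rw [hSdef]
    refine mul_le_mul_of_nonneg_left ?_ hcl0
    have hdy : (geo9K i).dist (bI f) y ≤ (ℓ : ℝ) + 4 := hkdist _ _ hf
    have hterm : ∀ c ∈ I, C * (geo9K i).len (bI f) ^ 2 * Real.exp (-(δ * (geo9K i).dist (bI f) c)) ≤
        C * (geo9K i).len y ^ 2 * Real.exp (2 * (δ * ((ℓ : ℝ) + 4))) * Real.exp (-(δ * (geo9K i).dist y y')) := by
      intro c hc
      rw [hIdef, Finset.mem_image] at hc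
      obtain ⟨f', hf', rfl⟩ := hc
      have hf'' : k y' f' ≠ 0 := (Finset.mem_filter.1 hf').2
      have hdy' : (geo9K i).dist (bI f') y' ≤ (ℓ : ℝ) + 4 := hkdist _ _ hf''
      have hlenle : (geo9K i).len (bI f) ^ 2 ≤ (geo9K i).len y ^ 2 := pow_le_pow_left₀ (hlen0 _) (hklen _ _ hf) 2
      have htri : (geo9K i).dist y y' ≤ (geo9K i).dist (bI f) y + (geo9K i).dist (bI f) (bI f') + (geo9K i).dist (bI f') y' := by
        have t1 := geo9K_dist_triangle i y (bI f) y'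
        have t2 := geo9K_dist_triangle i (bI f) (bI f') y'
        rw [geo9K_dist_comm i y (bI f)] at t1
        linarith
      have hexp : Real.exp (-(δ * (geo9K i).dist (bI f) (bI f'))) ≤
          Real.exp (2 * (δ * ((ℓ : ℝ) + 4))) * Real.exp (-(δ * (geo9K i).dist y y')) := by
        rw [← Real.exp_add]
        apply Real.exp_le_exp.2
        have := mul_le_mul_of_nonneg_left htri hδ
        nlinarith [mul_le_mul_of_nonneg_left hdy hδ, mul_le_mul_of_nonneg_left hdy' hδ]
      calc C * (geo9K i).len (bI f) ^ 2 * Real.exp (-(δ * (geo9K i).dist (bI f) (bI f')))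
          ≤ C * (geo9K i).len y ^ 2 * (Real.exp (2 * (δ * ((ℓ : ℝ) + 4))) * Real.exp (-(δ * (geo9K i).dist y y'))) :=
            mul_le_mul (mul_le_mul_of_nonneg_left hlenle hC) hexp (Real.exp_nonneg _) (mul_nonneg hC (pow_nonneg (hlen0 _) 2))
        _ = _ := by ring
    have hpos : 0 ≤ C * (geo9K i).len y ^ 2 * Real.exp (2 * (δ * ((ℓ : ℝ) + 4))) * Real.exp (-(δ * (geo9K i).dist y y')) := by
      positivity
    calc ∑ c ∈ I, C * (geo9K i).len (bI f) ^ 2 * Real.exp (-(δ * (geo9K i).dist (bI f) c))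
        ≤ I.card • (C * (geo9K i).len y ^ 2 * Real.exp (2 * (δ * ((ℓ : ℝ) + 4))) * Real.exp (-(δ * (geo9K i).dist y y'))) :=
          Finset.sum_le_card_nsmul _ _ _ hterm
      _ = (I.card : ℝ) * _ := by rw [nsmul_eq_mul]
      _ ≤ mN * _ := mul_le_mul_of_nonneg_right hIcard hpos
  have hS0 : 0 ≤ S := by rw [hSdef]; positivity
  -- the outer average through the row bound
  have hQ : ‖𝔮 (cfg U₁) (T (cfg U₁) lam) y‖ ≤ K * S := by
    refine (hrow _ y).trans ?_
    have hterm : ∀ f : FBondY i, k y f * ‖T (cfg U₁) lam f‖ ≤ k y f * S := by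
      intro f
      by_cases h : k y f = 0
      · rw [h, zero_mul, zero_mul]
      · exact mul_le_mul_of_nonneg_left (hmain f h) (hk0 _ _)
    calc ∑ f, k y f * ‖T (cfg U₁) lam f‖ ≤ ∑ f, k y f * S := Finset.sum_le_sum fun f _ => hterm f
      _ = (∑ f, k y f) * S := by rw [Finset.sum_mul]
      _ ≤ K * S := mul_le_mul_of_nonneg_right (hkmass y) hS0
  calc ‖QGQOfQY i 𝔮 𝔮s T (cfg U₁) (deltaY y' E) y‖ = ‖𝔮 (cfg U₁) (T (cfg U₁) lam) y‖ := by rw [hlam]; rfl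
    _ ≤ K * S := hQ
    _ = _ := by rw [hSdef, hcl]; ring

end Ineq2142

/-! ## §3 ★★ At print's knit averaging on the member's local class (3.35) -/

section Knit

open scoped Matrix.Norms.L2Operator

variable {N : ℕ} [Nonempty (Fin N)] (i : KIdx d ℓ hd hL b₀ b₁) {bI : FBondY i → IBondY i}

/-- ★★ **(2.142) AT `U` FOR `Q(U) T(U) Q⋆(U)` AT THE KNIT PAIR ON (3.35)**: at any letters `𝔮, 𝔮⋆` with `𝔮(cfg U₁) = QknitY i (cfg U₁)`, `𝔮⋆(cfg U₁) = adjTrY (QknitY i (cfg U₁))`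
(def-Y's knit pair of record), for `cfg U₁` in the member's local class `(bg9KP …).Reg335 c₀ α₀` (`G ≤ U(N)`, `c₀ ≤ 10`, `0 ≤ Mα₀`) with the x-free numerics `0 < α₀′ ≤ α_Q`,
`K_pl(Mα₀)·L⁴ < α₀′`, a level-∕1-faithful `bI`, the count `mN` and the [4]-(2.51) majorant `C(Lʲη)²e^{−δd}` of `GcoK … T U₁`:
`‖(QTQ⋆)(δ_{y′} ⊗ E)(y)‖ ≤ mN·((1 + 2(d+1)K_col α₀′)·N⁴·(1 + K_col α₀′)·C)·e^{2δ(ℓ+4)}·(Lʲη)(y)²·n_{y′}⁻¹·e^{−δd(y,y′)}·‖E‖`.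
[cite: Balaban1984PropagatorsII, (2.142) p.248, (2.51) p.232; Balaban1985BackgroundPropagators, (3.132) p.422, (3.115) p.418, (3.35) p.396; Balaban1985Averaging, (139)–(147) pp.39–40] -/
theorem norm_QGQOfQY_deltaY_le_knit [instF : Fintype (geo9K i).Site] {κ : Type} [Fintype κ] [DecidableEq κ]
    (bK : Module.Basis κ ℝ (Matrix (Fin N) (Fin N) ℂ)) {B : B9.Backgrounds} (cfg : B.Cfg → CfgY (Matrix (Fin N) (Fin N) ℂ) i) (T : BondOpY (Matrix (Fin N) (Fin N) ℂ) i)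
    (𝔮 : QLetterY (Matrix (Fin N) (Fin N) ℂ) i) (𝔮s : QsLetterY (Matrix (Fin N) (Fin N) ℂ) i) (U₁ : B.Cfg)
    (h𝔮 : 𝔮 (cfg U₁) = QknitY i (cfg U₁)) (h𝔮s : 𝔮s (cfg U₁) = adjTrY (QknitY i (cfg U₁)))
    {G : Subgroup (Matrix (Fin N) (Fin N) ℂ)ˣ} (hGU : G ≤ unitaryUnits (Matrix (Fin N) (Fin N) ℂ))
    {c₀ α₀ : ℝ} (hc : c₀ ≤ 10) (hMα : 0 ≤ (kGeo i).M * α₀) (hreg : (bg9KP (Matrix (Fin N) (Fin N) ℂ) G i).Reg335 c₀ α₀ (cfg U₁))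
    {α₀' : ℝ} (hα' : 0 < α₀') (hαQ : α₀' ≤ alphaQ (d + 1) (ℓ + 1)) (hK : Kpl i ((kGeo i).M * α₀) * (kGeo i).L ^ 4 < α₀')
    (hlev : ∀ f : FBondY i, lvl i.hN i.D i.hk (bI f) = (blkV1 i.hN i.D f).1.1)
    (hβ1 : ∀ f : FBondY i, (B6Geom246MultiLevelTorus.geomT i.D).dist (β i.hN i.D i.hk (bI f)) (blkV1 i.hN i.D f) ≤ 1)
    {mN : ℕ} (hnbr : ∀ y : (geo9K i).Site, (nbr (geo9K i) ((ℓ : ℝ) + 4) y).card ≤ mN)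
    {R : ℝ} {H : Prop} {C δ : ℝ} (hC : 0 ≤ C) (hδ : 0 ≤ δ)
    (h0 : HasMajorant (g := toB6 (geo9K i) R H) (blkBK i bI) (GcoK i bK B cfg T U₁)
      (fun a a' => C * (geo9K i).len a ^ 2 * Real.exp (-(δ * (geo9K i).dist a a'))))
    (y y' : IBondY i) (E : Matrix (Fin N) (Fin N) ℂ) :
    ‖QGQOfQY i 𝔮 𝔮s T (cfg U₁) (deltaY y' E) y‖ ≤
      mN * ((1 + kCol (d + 1) (ℓ + 1) * α₀' * (2 * ((d : ℝ) + 1))) * (N : ℝ) ^ 4 * (1 + kCol (d + 1) (ℓ + 1) * α₀') * C) *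
        Real.exp (2 * (δ * ((ℓ : ℝ) + 4))) * (geo9K i).len y ^ 2 * ((((ℓ + 1 : ℕ) : ℝ) ^ (d + 1)) ^ (lvl i.hN i.D i.hk y'))⁻¹ *
        Real.exp (-(δ * (geo9K i).dist y y')) * ‖E‖ := by
  letI : CStarAlgebra (Matrix (Fin N) (Fin N) ℂ) := {}
  have hk0 : ∀ ι f, 0 ≤ qwt i.hN i.D i.hk ι f + kCol (d + 1) (ℓ + 1) * α₀' * boxK i ι f :=
    fun ι f => add_nonneg (qwt_nonneg _ _ _ _ _) (mul_nonneg (mul_nonneg (kCol_nonneg _ _) hα'.le) (boxK_nonneg i ι f))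
  have hkc : 0 ≤ kCol (d + 1) (ℓ + 1) * α₀' := mul_nonneg (kCol_nonneg _ _) hα'.le
  have hrow : ∀ (a : FBondY i → Matrix (Fin N) (Fin N) ℂ) (y : IBondY i),
      ‖𝔮 (cfg U₁) a y‖ ≤ ∑ f, (qwt i.hN i.D i.hk y f + kCol (d + 1) (ℓ + 1) * α₀' * boxK i y f) * ‖a f‖ := by
    intro a y; rw [h𝔮]; exact norm_QknitY_apply_le_sum_knitRow i hGU hc hMα hreg hα' hαQ hK a y
  have hcol : ∀ (Ψ : IBondY i → Matrix (Fin N) (Fin N) ℂ) (f : FBondY i),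
      ‖𝔮s (cfg U₁) Ψ f‖ ≤ (N : ℝ) ^ 4 * ∑ ι, (qwt i.hN i.D i.hk ι f + kCol (d + 1) (ℓ + 1) * α₀' * boxK i ι f) * ‖Ψ ι‖ := by
    intro Ψ f; rw [h𝔮s]
    exact norm_adjTrY_apply_le_of_rowKernel i (QknitY i (cfg U₁)) _ hk0 (norm_QknitY_apply_le_sum_knitRow i hGU hc hMα hreg hα' hαQ hK) Ψ f
  exact norm_QGQOfQY_deltaY_le i bK cfg T 𝔮 𝔮s U₁ hβ1 hnbr _ hk0
    (fun _ _ h => by rw [geo9K_dist_comm]; exact dist_le_of_knitRow_ne_zero_bI i hβ1 h) (fun _ _ h => len_bI_le_of_knitRow_ne_zero i hlev h)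
    (by positivity) (knitRow_le_plateau i hα'.le) (sum_knitRow_le i hα'.le) hrow (by positivity) hcol hC hδ h0 y y' E

end Knit

end Summit.QuantumFields.YangMills.BalabanUVNodes.N06Eq3132Ineq2142KnitQ

end
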